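import Summits.CriticalPhenomena.SAWScalingLimit.Theorems.BoundaryClosureNegative_Instance

/-!
# Negative lemma for the crux `SAWDevelopingMap.ObservableToSLE` (stmt-CriticalPhenomena-10472), line
`floor-ratio-restriction-bootstrap` — the root-rows clause of the floor-ratio limit is load-bearing.
Part 1 (lattice side): the second normalisation edge `bEdgeQ (Nc δ)` at `1/4`, its boundary membership
and limit, the straight self-avoiding walk to it, and the equality of the floor ratios of the two
corridor configurations (`ratio_eq_corridor`).

Support for `FloorRatioLimitRootPinning.lean` (refuter, drefute, 2026-08-16); built on the landed
corridor modules `BoundaryClosureNegative_*`.  Everything proved. [folklore]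
-/

noncomputable section

open Set Filter Topology Complex MeasureTheory Metric
open scoped BigOperators NNReal ENNReal Classical
open Literature.Probability.RandomPlanarGeometry
open UpperHalfPlane (upperHalfPlaneSet)
open Literature.Probability.LatticeModels Literature.Probability.RandomPlanarGeometry.SAW

namespace Summit.CriticalPhenomena.SAWScalingLimit.Theorems.ObservableToSLE.Negative

open Summit.CriticalPhenomena.SAWScalingLimit.Theorems.BoundaryClosure.Negative

/-! ## §1 The second normalisation edge `b'` at cell `N` and the cell `Nc δ = ⌊1/(4δ)⌋` -/

/-- The vertical boundary mid-edge below the row-`0` face of cell `N` (midpoint `N + 1/2`);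
`bEdgeQ 0 = bEdge`. [folklore] -/
def bEdgeQ (N : ℤ) : Sym2 HexVertex := s(fj (2 * N) 0, fj (2 * N + 1) (-1))

/-- The cell of the second normalisation point `1/4`. [folklore] -/
def Nc (δ : ℝ) : ℤ := ⌊1 / (4 * δ)⌋

/-- The midpoint of `bEdgeQ N` is the real number `N + 1/2`. [folklore] -/
theorem hexMidpoint_bEdgeQ (N : ℤ) : hexMidpoint (bEdgeQ N) = (((N : ℝ) + 1 / 2 : ℝ) : ℂ) := by
  unfold bEdgeQ
  rw [hexMidpoint_mk]
  apply Complex.ext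
  · simp only [Complex.add_re, Complex.div_ofNat_re, re_hexCenter_fj, Complex.ofReal_re]
    push_cast; ring
  · simp only [Complex.add_im, Complex.div_ofNat_im, im_hexCenter_fj, Complex.ofReal_im]
    rw [show (2 * N) % 2 = 0 by omega, show (2 * N + 1) % 2 = 1 by omega]
    push_cast; ring

/-- Bounds on the cell `Nc δ`: `1/(4δ) - 1 < Nc δ ≤ 1/(4δ)`. [folklore] -/
theorem Nc_bounds (δ : ℝ) : (Nc δ : ℝ) ≤ 1 / (4 * δ) ∧ 1 / (4 * δ) - 1 < (Nc δ : ℝ) :=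
  ⟨Int.floor_le _, Int.sub_one_lt_floor _⟩

/-- `|δ · Nc δ - 1/4| ≤ δ`. [folklore] -/
theorem abs_Nc (δ : ℝ) (hδ : 0 < δ) : |δ * Nc δ - 1 / 4| ≤ δ := by
  have h := Nc_bounds δ
  have e : 1 / (4 * δ) = δ⁻¹ / 4 := by rw [one_div, mul_inv, inv_eq_one_div (4:ℝ)]; ring
  rw [e] at h
  have e' : δ * δ⁻¹ = 1 := mul_inv_cancel₀ hδ.ne'
  rw [abs_le]; constructor <;> nlinarith [h.1, h.2]

/-- For `0 < δ ≤ 1/16`: `1 ≤ Nc δ < Xc δ`. [folklore] -/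
theorem Nc_pos_lt_Xc {δ : ℝ} (hδ : 0 < δ) (hδ' : δ ≤ 1 / 16) : 1 ≤ Nc δ ∧ Nc δ < Xc δ := by
  have h := Nc_bounds δ
  have hX := (Xc_bounds δ).1
  have e : 1 / (4 * δ) = δ⁻¹ / 4 := by rw [one_div, mul_inv, inv_eq_one_div (4:ℝ)]; ring
  rw [e] at h
  rw [one_div_two_mul] at hX
  have h16 := sixteen_le_inv hδ hδ'
  constructor
  · have : (0 : ℝ) < Nc δ := by linarith [h.2]
    exact_mod_cast (show (0 : ℤ) < Nc δ by exact_mod_cast this)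
  · have : (Nc δ : ℝ) < Xc δ := by
      have : (0:ℝ) < δ⁻¹ := by positivity
      linarith [h.1]
    exact_mod_cast this

/-- **The rescaled second normalisation mid-edge converges to `1/4`.** [folklore] -/
theorem tendsto_smul_midpoint_bEdgeQ :
    Tendsto (fun δ : ℝ => (δ : ℂ) * hexMidpoint (bEdgeQ (Nc δ))) (𝓝[>] 0)
      (𝓝 (((1 / 4 : ℝ)) : ℂ)) := by
  have e : (fun δ : ℝ => (δ : ℂ) * hexMidpoint (bEdgeQ (Nc δ))) =
      fun δ : ℝ => ((δ * ((Nc δ : ℝ) + 1 / 2) : ℝ) : ℂ) := by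
    funext δ; rw [hexMidpoint_bEdgeQ]; push_cast; ring
  rw [e]
  refine (Complex.continuous_ofReal.tendsto _).comp ?_
  have h0 : Tendsto (fun δ : ℝ => δ) (𝓝[>] 0) (𝓝 0) :=
    tendsto_nhdsWithin_of_tendsto_nhds tendsto_id
  rw [Metric.tendsto_nhds]
  intro ε hε
  have hev : ∀ᶠ δ : ℝ in 𝓝[>] 0, 0 < δ ∧ δ < ε / 4 := by
    have h1 : ∀ᶠ δ : ℝ in 𝓝[>] 0, 0 < δ := eventually_nhdsWithin_of_forall fun x hx => hx
    have h2 : ∀ᶠ δ : ℝ in 𝓝[>] 0, δ < ε / 4 := by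
      have := (Metric.tendsto_nhds.1 h0) (ε / 4) (by positivity)
      refine this.mono fun x hx => ?_
      rw [Real.dist_eq, sub_zero] at hx
      exact (le_abs_self _).trans_lt hx
    exact h1.and h2
  refine hev.mono fun δ ⟨hδ0, hδε⟩ => ?_
  have := abs_Nc δ hδ0
  rw [Real.dist_eq]
  calc |δ * ((Nc δ : ℝ) + 1 / 2) - 1 / 4| = |(δ * Nc δ - 1 / 4) + δ * (1 / 2)| := by ring_nf
    _ ≤ |δ * Nc δ - 1 / 4| + |δ * (1 / 2)| := abs_add_le _ _
    _ ≤ δ + δ * (1 / 2) := by rw [abs_of_pos (by positivity : (0:ℝ) < δ * (1 / 2))]; linarith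
    _ < ε := by linarith

section Geometry

variable {δ : ℝ} (hδ : 0 < δ) (hδ' : δ ≤ 1 / 16) (wc : Bool)
include hδ hδ'

/-- The face below the row-`0` face of cell `N` is not a vertex. [folklore] -/
theorem fj_neg_one_not_mem (j : ℤ) : fj j (-1) ∉ Lam δ wc := by
  rw [fj_mem_Lam_iff hδ hδ']
  rintro (hb | ⟨-, hc, -⟩)
  · have := hb.1.1.1; omega
  · omega

/-- **The second normalisation edge is a boundary mid-edge.** [folklore] -/
theorem bEdgeQ_mem_boundary : bEdgeQ (Nc δ) ∈ hexDomainBoundary (Lam δ wc) := by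
  have hb := rootCell_bounds hδ hδ' wc
  have hN := Nc_pos_lt_Xc hδ hδ'
  refine ⟨(SimpleGraph.mem_edgeSet hexGraph).2 ?_, fj (2 * Nc δ + 1) (-1), fj (2 * Nc δ) 0,
    Sym2.eq_swap, fj_row_zero_mem hδ hδ' wc (by omega) (by omega), fj_neg_one_not_mem hδ hδ' wc _⟩
  have := adj_fj_down (show (2 * Nc δ) % 2 = 0 by omega) 0
  rwa [show (0:ℤ) - 1 = -1 by norm_num] at this

end Geometry

/-! ### The straight walk along row `0` from the root edge down to `bEdgeQ k` -/

/-- The straight walk `[fj (k+m) 0, …, fj k 0]` along row `0`. [folklore] -/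
def rowWalkFrom (k : ℤ) : ℕ → List HexVertex
  | 0 => [fj k 0]
  | m + 1 => fj (k + (m + 1 : ℕ)) 0 :: rowWalkFrom k m

/-- Members of the straight walk. [folklore] -/
theorem mem_rowWalkFrom {k : ℤ} {m : ℕ} {v : HexVertex} :
    v ∈ rowWalkFrom k m ↔ ∃ i : ℕ, i ≤ m ∧ v = fj (k + i) 0 := by
  induction m with
  | zero =>
    simp only [rowWalkFrom, List.mem_singleton, Nat.le_zero]
    constructor
    · rintro rfl; exact ⟨0, rfl, by simp⟩
    · rintro ⟨i, rfl, rfl⟩; simp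
  | succ m ih =>
    simp only [rowWalkFrom, List.mem_cons, ih]
    constructor
    · rintro (rfl | ⟨i, hi, rfl⟩)
      · exact ⟨m + 1, le_rfl, rfl⟩
      · exact ⟨i, by omega, rfl⟩
    · rintro ⟨i, hi, rfl⟩
      rcases Nat.lt_or_ge i (m + 1) with h | h
      · exact Or.inr ⟨i, by omega, rfl⟩
      · left; have : i = m + 1 := by omega
        subst this; rfl

/-- The straight walk is nonempty. [folklore] -/
theorem rowWalkFrom_ne_nil (k : ℤ) (m : ℕ) : rowWalkFrom k m ≠ [] := by
  cases m <;> simp [rowWalkFrom]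

/-- Head of the straight walk. [folklore] -/
theorem head?_rowWalkFrom (k : ℤ) (m : ℕ) : (rowWalkFrom k m).head? = some (fj (k + m) 0) := by
  cases m with
  | zero => simp [rowWalkFrom]
  | succ m => simp [rowWalkFrom]

/-- The straight walk decomposes as head and tail walk. [folklore] -/
theorem rowWalkFrom_succ (k : ℤ) (m : ℕ) :
    rowWalkFrom k (m + 1) = fj (k + (m + 1 : ℕ)) 0 :: rowWalkFrom k m := rfl

/-- Last element of the straight walk. [folklore] -/
theorem getLast?_rowWalkFrom (k : ℤ) (m : ℕ) : (rowWalkFrom k m).getLast? = some (fj k 0) := by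
  induction m with
  | zero => rfl
  | succ m ih =>
    obtain ⟨b, l, hbl⟩ := List.exists_cons_of_ne_nil (rowWalkFrom_ne_nil k m)
    rw [rowWalkFrom_succ, hbl, List.getLast?_cons_cons, ← hbl, ih]

/-- The straight walk has no repeated vertex. [folklore] -/
theorem nodup_rowWalkFrom (k : ℤ) (m : ℕ) : (rowWalkFrom k m).Nodup := by
  induction m with
  | zero => simp [rowWalkFrom]
  | succ m ih =>
    rw [rowWalkFrom_succ, List.nodup_cons]
    refine ⟨fun h => ?_, ih⟩
    obtain ⟨i, hi, he⟩ := mem_rowWalkFrom.1 h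
    have := (fj_inj.1 he).1; push_cast at this; omega

/-- The straight walk is a chain of adjacent faces. [folklore] -/
theorem isChain_rowWalkFrom (k : ℤ) (m : ℕ) : (rowWalkFrom k m).IsChain hexGraph.Adj := by
  induction m with
  | zero => exact List.isChain_singleton _
  | succ m ih =>
    obtain ⟨b, l, hbl⟩ := List.exists_cons_of_ne_nil (rowWalkFrom_ne_nil k m)
    have hb : b = fj (k + m) 0 := by
      have := head?_rowWalkFrom k m
      rw [hbl] at this
      simpa using this
    rw [rowWalkFrom_succ, hbl]
    rw [hbl] at ih
    refine List.IsChain.cons_cons ?_ ih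
    rw [hb]
    have := (adj_fj_succ (k + m) 0).symm
    push_cast
    rwa [show k + (m : ℤ) + 1 = k + ((m : ℤ) + 1) by ring] at this

/-- **The straight walk as a self-avoiding walk** from the root edge at cell `N` to `bEdgeQ k`,
`0 ≤ k ≤ N`, in any vertex set containing the faces `fj i 0`, `0 ≤ i ≤ 2N+1`. [folklore] -/
theorem nonempty_rowSAW_bEdgeQ (Λ : Finset HexVertex) (k N : ℕ) (hkN : k ≤ N)
    (hΛ : ∀ i : ℕ, i ≤ 2 * N + 1 → fj i 0 ∈ Λ) :
    Nonempty (HexMidEdgeSAW Λ (aEdge N) (bEdgeQ k)) := by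
  -- the walk visits `fj (2k + i) 0`, `i = 2(N-k)+1, …, 0`
  set M : ℕ := 2 * (N - k) + 1 with hM
  have hkM : (2 * k : ℤ) + M = 2 * N + 1 := by rw [hM]; push_cast; omega
  have hmem : ∀ e ∈ List.zipWith (fun u w => s(u, w)) (rowWalkFrom (2 * k) M) (rowWalkFrom (2 * k) M).tail,
      ∀ c ∈ e, ∃ i : ℕ, i ≤ M ∧ c = fj (2 * k + i) 0 := fun e he c hc =>
    mem_rowWalkFrom.1 (forall_mem_of_mem_edges _ e he c hc)
  have haL : aEdge (N : ℤ) ∉ List.zipWith (fun u w => s(u, w)) (rowWalkFrom (2 * k) M)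
      (rowWalkFrom (2 * k) M).tail := by
    intro h
    obtain ⟨i, hi, he⟩ := hmem _ h (fj (2 * N + 2) 0) (by unfold aEdge; exact Sym2.mem_mk_left _ _)
    have := (fj_inj.1 he).1; omega
  have hab : aEdge (N : ℤ) ≠ bEdgeQ k := by
    intro h
    have : fj (2 * (N : ℤ) + 2) 0 ∈ bEdgeQ k := by rw [← h]; unfold aEdge; exact Sym2.mem_mk_left _ _
    unfold bEdgeQ at this
    rcases Sym2.mem_iff.1 this with h1 | h1
    · have := (fj_inj.1 h1).1; omega
    · have := (fj_inj.1 h1).2; omega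
  have hbL : bEdgeQ (k : ℤ) ∉ List.zipWith (fun u w => s(u, w)) (rowWalkFrom (2 * k) M)
      (rowWalkFrom (2 * k) M).tail := by
    intro he
    obtain ⟨i, hi, he'⟩ := hmem _ he (fj (2 * k + 1) (-1)) (by exact Sym2.mem_mk_right _ _)
    have := (fj_inj.1 he').2; omega
  have hadj : hexGraph.Adj (fj (2 * (N : ℤ) + 2) 0) (fj (2 * N + 1) 0) := by
    have := (adj_fj_succ (2 * (N : ℤ) + 1) 0).symm
    rwa [show 2 * (N : ℤ) + 1 + 1 = 2 * N + 2 by ring] at this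
  refine ⟨{ verts := rowWalkFrom (2 * k) M
            subset := fun v hv => ?_
            nodup := nodup_rowWalkFrom _ _
            isChain := isChain_rowWalkFrom _ _
            head_mem := fun v hv => ?_
            getLast_mem := fun v hv => ?_
            eq_of_nil := fun h => (rowWalkFrom_ne_nil _ _ h).elim
            edges_nodup := fun _ => ?_
            fst_mem := ⟨(SimpleGraph.mem_edgeSet hexGraph).2 hadj, fj (2 * N + 1) 0,
              by unfold aEdge; exact Sym2.mem_mk_right _ _, by exact_mod_cast hΛ (2 * N + 1) le_rfl⟩ }⟩
  · obtain ⟨i, hi, rfl⟩ := mem_rowWalkFrom.1 hv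
    have := hΛ (2 * k + i) (by omega)
    push_cast at this ⊢
    exact this
  · rw [head?_rowWalkFrom, Option.some_inj] at hv
    subst hv
    rw [hkM]
    unfold aEdge
    exact Sym2.mem_mk_right _ _
  · rw [getLast?_rowWalkFrom, Option.some_inj] at hv
    subst hv
    unfold bEdgeQ
    exact Sym2.mem_mk_left _ _
  · have hL := edges_nodup (nodup_rowWalkFrom (2 * (k : ℤ)) M)
    refine List.nodup_append.2 ⟨List.nodup_cons.2 ⟨haL, hL⟩, List.nodup_singleton _, ?_⟩
    intro e he f hf
    rw [List.mem_singleton] at hf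
    subst hf
    rcases List.mem_cons.1 he with rfl | he
    · exact hab
    · rintro rfl; exact hbL he

section Geometry

variable {δ : ℝ} (hδ : 0 < δ) (hδ' : δ ≤ 1 / 16) (wc : Bool)
include hδ hδ'

/-- **There is a self-avoiding walk from the root edge to the second normalisation edge.** [folklore] -/
theorem nonempty_saw_bEdgeQ :
    Nonempty (HexMidEdgeSAW (Lam δ wc) (aEdge (rootCell δ wc)) (bEdgeQ (Nc δ))) := by
  have hb := rootCell_bounds hδ hδ' wc
  have hX := Xc_pos hδ (δ := δ)
  have hN := Nc_pos_lt_Xc hδ hδ'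
  obtain ⟨N, hN'⟩ : ∃ N : ℕ, (N : ℤ) = rootCell δ wc := ⟨(rootCell δ wc).toNat, by omega⟩
  obtain ⟨k, hk⟩ : ∃ k : ℕ, (k : ℤ) = Nc δ := ⟨(Nc δ).toNat, by omega⟩
  rw [← hN', ← hk]
  exact nonempty_rowSAW_bEdgeQ (Lam δ wc) k N (by omega)
    fun i hi => fj_row_zero_mem hδ hδ' wc (by omega) (by omega)

/-- The second normalisation edge avoids the corridor faces. [folklore] -/
theorem corridor_not_mem_bEdgeQ (i : ℤ) (hi : 2 * Xc δ + 2 ≤ i) : fj i 0 ∉ bEdgeQ (Nc δ) := by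
  have hN := Nc_pos_lt_Xc hδ hδ'
  unfold bEdgeQ
  intro hmem
  rcases Sym2.mem_iff.1 hmem with h | h
  · have := (fj_inj.1 h).1; omega
  · have := (fj_inj.1 h).2; omega

omit hδ hδ' in
/-- The first normalisation edge avoids the corridor faces. [folklore] -/
theorem corridor_not_mem_bEdge (hX : 0 < Xc δ) (i : ℤ) (hi : 2 * Xc δ + 2 ≤ i) : fj i 0 ∉ bEdge := by
  unfold bEdge
  intro hmem
  rcases Sym2.mem_iff.1 hmem with h | h
  · have := (fj_inj.1 h).1; omega
  · have := (fj_inj.1 h).2; omega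

/-- **The two configurations have the same floor ratio**: for `0 < δ ≤ 1/16`,
`F^{body∪corridor}_{a_T}(b')/F^{body∪corridor}_{a_T}(b) = F^{body}_{a_X}(b')/F^{body}_{a_X}(b)`.
[folklore] -/
theorem ratio_eq_corridor (x σ : ℝ) (hx : x ≠ 0) :
    hexParafermionicObservable (Lam δ true) (aEdge (Tc δ)) x σ (bEdgeQ (Nc δ)) /
        hexParafermionicObservable (Lam δ true) (aEdge (Tc δ)) x σ bEdge =
      hexParafermionicObservable (Lam δ false) (aEdge (Xc δ)) x σ (bEdgeQ (Nc δ)) /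
        hexParafermionicObservable (Lam δ false) (aEdge (Xc δ)) x σ bEdge := by
  obtain ⟨κ, hκ, hrel⟩ := observable_corridor hδ hδ' x σ hx
  have hX := Xc_pos hδ (δ := δ)
  rw [hrel _ fun i hi => corridor_not_mem_bEdgeQ hδ hδ' i hi,
    hrel _ fun i hi => corridor_not_mem_bEdge hX i hi, mul_div_mul_left _ _ hκ]

end Geometry

end Summit.CriticalPhenomena.SAWScalingLimit.Theorems.ObservableToSLE.Negative

end
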